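import Mathlib

/-!
# Crux `SignCone.ConeMagnification` (stmt-RiemannHypothesis-16303), line `Sketch` r8:
# Abel's theorem for Dirichlet series (regular averaging by the weights `(i+1)^{-u} − (i+2)^{-u}`)

Real-variable lemma used to identify the value at `s = 1` of the continuation `F = L_c − 1/(s−1)` with the
Mertens constant of `c`:

* `DirichletAbel.hasSum_parts` — summation by parts in the limit: for bounded partial sums `G(N) = Σ_{i<N} a(i)` and
  `u > 0`, `Σ_i a(i)(i+1)^{-u} = Σ_i ((i+1)^{-u} − (i+2)^{-u}) G(i+1)`;
* `DirichletAbel.abel_dirichlet` — **Abel's theorem for Dirichlet series**: if `G(N) → S` then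
  `Σ_i a(i)(i+1)^{-u} → S` as `u → 0+` (the weights are nonnegative, sum to `1`, and the mass of any initial
  segment `1 − (N₀+1)^{-u}` tends to `0`).
-/

noncomputable section

-- `Summit.RiemannHypothesis.RiemannHypothesis.…` repeats a namespace component by design (D-0017 layout).
set_option linter.dupNamespace false

open scoped BigOperators Topology
open Set Filter Metric

namespace Summit.RiemannHypothesis.RiemannHypothesis.Theorems.SignConeConeMagnification

namespace DirichletAbel

/-! ### The weights `(i+1)^{-u}` -/

/-- `(i+1)^{-u} > 0`. [folklore] -/
theorem weight_pos (u : ℝ) (i : ℕ) : 0 < ((i : ℝ) + 1) ^ (-u) := Real.rpow_pos_of_pos (by positivity) _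

/-- `(i+1)^{-u} ≤ 1` for `u ≥ 0`. [folklore] -/
theorem weight_le_one {u : ℝ} (hu : 0 ≤ u) (i : ℕ) : ((i : ℝ) + 1) ^ (-u) ≤ 1 :=
  Real.rpow_le_one_of_one_le_of_nonpos (by linarith [(Nat.cast_nonneg i : (0 : ℝ) ≤ i)]) (by linarith)

/-- The weights `w_i = (i+1)^{-u} − (i+2)^{-u}` are nonnegative for `u ≥ 0`. [folklore] -/
theorem diff_nonneg {u : ℝ} (hu : 0 ≤ u) (i : ℕ) : 0 ≤ ((i : ℝ) + 1) ^ (-u) - ((i : ℝ) + 1 + 1) ^ (-u) :=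
  sub_nonneg.2 (Real.rpow_le_rpow_of_nonpos (by positivity) (by linarith) (by linarith))

/-- Telescoping: `Σ_{i<M} w_i = 1 − (M+1)^{-u}`. [folklore] -/
theorem sum_diff (u : ℝ) (M : ℕ) :
    ∑ i ∈ Finset.range M, (((i : ℝ) + 1) ^ (-u) - ((i : ℝ) + 1 + 1) ^ (-u)) = 1 - ((M : ℝ) + 1) ^ (-u) := by
  induction M with
  | zero => simp
  | succ M ih =>
    rw [Finset.sum_range_succ, ih]
    push_cast
    ring

/-- The weights are summable with sum `1` (`u > 0`). [folklore] -/
theorem hasSum_diff {u : ℝ} (hu : 0 < u) :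
    HasSum (fun i : ℕ => ((i : ℝ) + 1) ^ (-u) - ((i : ℝ) + 1 + 1) ^ (-u)) 1 := by
  have hsw : Summable (fun i : ℕ => ((i : ℝ) + 1) ^ (-u) - ((i : ℝ) + 1 + 1) ^ (-u)) := by
    refine summable_of_sum_range_le (diff_nonneg hu.le) (c := 1) fun M => ?_
    rw [sum_diff u M]
    linarith [weight_pos u M]
  rw [hsw.hasSum_iff_tendsto_nat]
  have h1 : Tendsto (fun M : ℕ => 1 - ((M : ℝ) + 1) ^ (-u)) atTop (𝓝 (1 - 0)) :=
    tendsto_const_nhds.sub ((tendsto_rpow_neg_atTop hu).comp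
      (tendsto_atTop_add_const_right _ _ tendsto_natCast_atTop_atTop))
  rw [sub_zero] at h1
  exact h1.congr fun M => (sum_diff u M).symm

/-! ### Summation by parts in the limit -/

/-- **Summation by parts, in the limit.**  If `|G(N)| ≤ B` for the partial sums `G(N) = Σ_{i<N} a(i)` and
`Σ a(i)(i+1)^{-u}` is summable (`u > 0`), then `Σ_i a(i)(i+1)^{-u} = Σ_i ((i+1)^{-u} − (i+2)^{-u}) G(i+1)`, the right
side converging absolutely. [folklore] -/
theorem hasSum_parts {a : ℕ → ℝ} {B : ℝ} (hB : ∀ N, |∑ i ∈ Finset.range N, a i| ≤ B) {u : ℝ} (hu : 0 < u)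
    (hs : Summable (fun i : ℕ => a i * ((i : ℝ) + 1) ^ (-u))) :
    HasSum (fun i : ℕ => (((i : ℝ) + 1) ^ (-u) - ((i : ℝ) + 1 + 1) ^ (-u)) * ∑ j ∈ Finset.range (i + 1), a j)
      (∑' i : ℕ, a i * ((i : ℝ) + 1) ^ (-u)) := by
  set f : ℕ → ℝ := fun i => ((i : ℝ) + 1) ^ (-u) with hf
  set G : ℕ → ℝ := fun N => ∑ i ∈ Finset.range N, a i with hG
  have hB0 : 0 ≤ B := (abs_nonneg _).trans (hB 0)
  have hf1 : ∀ i : ℕ, f (i + 1) = ((i : ℝ) + 1 + 1) ^ (-u) := fun i => by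
    simp only [hf, Nat.cast_add, Nat.cast_one]
  have hw_nonneg : ∀ i : ℕ, 0 ≤ f i - f (i + 1) := fun i => by rw [hf1]; exact diff_nonneg hu.le i
  -- absolute summability of the right side
  have hprod : Summable (fun i : ℕ => (f i - f (i + 1)) * G (i + 1)) := by
    refine Summable.of_norm_bounded (g := fun i => (((i : ℝ) + 1) ^ (-u) - ((i : ℝ) + 1 + 1) ^ (-u)) * B)
      ((hasSum_diff hu).summable.mul_right B) fun i => ?_
    rw [Real.norm_eq_abs, abs_mul, abs_of_nonneg (hw_nonneg i), hf1]
    exact mul_le_mul_of_nonneg_left (hB (i + 1)) (diff_nonneg hu.le i)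
  -- finite summation by parts
  have hfin : ∀ N : ℕ, ∑ i ∈ Finset.range N, f i * a i =
      f (N - 1) * G N - ∑ i ∈ Finset.range (N - 1), (f (i + 1) - f i) * G (i + 1) := by
    intro N
    simpa only [smul_eq_mul, hG] using Finset.sum_range_by_parts f a N
  -- limits of the pieces
  have hL : Tendsto (fun N : ℕ => ∑ i ∈ Finset.range N, f i * a i) atTop
      (𝓝 (∑' i : ℕ, a i * ((i : ℝ) + 1) ^ (-u))) := by
    refine hs.hasSum.tendsto_sum_nat.congr fun N => Finset.sum_congr rfl fun i _ => ?_
    simp only [hf]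
    ring
  have hBd : Tendsto (fun N : ℕ => f (N - 1) * G N) atTop (𝓝 0) := by
    have hf0 : Tendsto (fun N : ℕ => f (N - 1)) atTop (𝓝 0) := by
      have h1 : Tendsto (fun N : ℕ => ((N - 1 : ℕ) : ℝ) + 1) atTop atTop :=
        tendsto_atTop_add_const_right _ _ (tendsto_natCast_atTop_atTop.comp (tendsto_sub_atTop_nat 1))
      exact (tendsto_rpow_neg_atTop hu).comp h1
    refine squeeze_zero_norm (fun N => ?_) (by simpa using hf0.mul_const B)
    rw [Real.norm_eq_abs, abs_mul, abs_of_pos (weight_pos u _)]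
    exact mul_le_mul_of_nonneg_left (hB N) (weight_pos u _).le
  have hR : Tendsto (fun N : ℕ => ∑ i ∈ Finset.range (N - 1), (f (i + 1) - f i) * G (i + 1)) atTop
      (𝓝 (∑' i : ℕ, (f (i + 1) - f i) * G (i + 1))) := by
    have hneg : Summable (fun i : ℕ => (f (i + 1) - f i) * G (i + 1)) :=
      hprod.neg.congr fun i => by ring
    exact hneg.hasSum.tendsto_sum_nat.comp (tendsto_sub_atTop_nat 1)
  have hlim : Tendsto (fun N : ℕ => ∑ i ∈ Finset.range N, f i * a i) atTop
      (𝓝 (0 - ∑' i : ℕ, (f (i + 1) - f i) * G (i + 1))) :=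
    (hBd.sub hR).congr fun N => (hfin N).symm
  have heq := tendsto_nhds_unique hL hlim
  have hval : (∑' i : ℕ, a i * ((i : ℝ) + 1) ^ (-u)) = ∑' i : ℕ, (f i - f (i + 1)) * G (i + 1) := by
    rw [heq, zero_sub, ← tsum_neg]
    exact tsum_congr fun i => by ring
  rw [hval]
  refine (hprod.hasSum).congr_fun fun i => ?_
  rw [hf1]

/-! ### Abel's theorem -/

/-- **Abel's theorem for Dirichlet series.**  If the partial sums `Σ_{i<N} a(i)` converge to `S` and the series
`Σ a(i)(i+1)^{-u}` are summable for `u > 0`, then `Σ_i a(i)(i+1)^{-u} → S` as `u → 0+`. [folklore] -/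
theorem abel_dirichlet {a : ℕ → ℝ} {S : ℝ}
    (hGS : Tendsto (fun N : ℕ => ∑ i ∈ Finset.range N, a i) atTop (𝓝 S))
    (hs : ∀ u : ℝ, 0 < u → Summable (fun i : ℕ => a i * ((i : ℝ) + 1) ^ (-u))) :
    Tendsto (fun u : ℝ => ∑' i : ℕ, a i * ((i : ℝ) + 1) ^ (-u)) (𝓝[>] 0) (𝓝 S) := by
  set G : ℕ → ℝ := fun N => ∑ i ∈ Finset.range N, a i with hG
  -- `|G N - S| ≤ K`, `|G N| ≤ B`
  obtain ⟨K, hK0, hK⟩ : ∃ K : ℝ, 0 ≤ K ∧ ∀ N, |G N - S| ≤ K := by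
    obtain ⟨C, hC⟩ := isBounded_iff_forall_norm_le.1 (Metric.isBounded_range_of_tendsto _ (hGS.sub_const S))
    exact ⟨max C 0, le_max_right _ _, fun N => (hC _ ⟨N, rfl⟩).trans (le_max_left _ _)⟩
  have hB : ∀ N, |G N| ≤ K + |S| := fun N => by
    have := abs_add_le (G N - S) S
    rw [sub_add_cancel] at this
    linarith [hK N]
  rw [Metric.tendsto_nhdsWithin_nhds]
  intro ε hε
  obtain ⟨N₀, hN₀⟩ : ∃ N₀ : ℕ, ∀ N, N₀ ≤ N → |G N - S| < ε / 2 := by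
    obtain ⟨N₀, h⟩ := Metric.tendsto_atTop.1 hGS (ε / 2) (by linarith)
    exact ⟨N₀, fun N hN => by have := h N hN; rwa [Real.dist_eq] at this⟩
  -- `δ` with `(K+1)(1 − (N₀+1)^{-u}) < ε/2` for `|u| < δ`
  have hcont : Tendsto (fun u : ℝ => ((N₀ : ℝ) + 1) ^ (-u)) (𝓝 0) (𝓝 1) := by
    have h : Continuous fun u : ℝ => ((N₀ : ℝ) + 1) ^ (-u) :=
      (Real.continuous_const_rpow (by positivity : ((N₀ : ℝ) + 1) ≠ 0)).comp continuous_neg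
    simpa using h.tendsto 0
  have hsmall : ∀ᶠ u in 𝓝 (0 : ℝ), (K + 1) * (1 - ((N₀ : ℝ) + 1) ^ (-u)) < ε / 2 := by
    have h2 : Tendsto (fun u : ℝ => (K + 1) * (1 - ((N₀ : ℝ) + 1) ^ (-u))) (𝓝 0) (𝓝 0) := by
      have h3 : Tendsto (fun u : ℝ => (K + 1) * (1 - ((N₀ : ℝ) + 1) ^ (-u))) (𝓝 0)
          (𝓝 ((K + 1) * (1 - 1))) :=
        ((tendsto_const_nhds (x := (1 : ℝ))).sub hcont).const_mul (K + 1)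
      simpa using h3
    exact h2.eventually (gt_mem_nhds (by linarith))
  obtain ⟨δ, hδ, hδu⟩ := Metric.eventually_nhds_iff.1 hsmall
  refine ⟨δ, hδ, fun u hu hdist => ?_⟩
  have hu0 : 0 < u := hu
  have hsmallu := hδu hdist
  -- the two `HasSum`s
  have hT := hasSum_parts (a := a) hB hu0 (hs u hu0)
  have hW := hasSum_diff hu0
  set w : ℕ → ℝ := fun i => ((i : ℝ) + 1) ^ (-u) - ((i : ℝ) + 1 + 1) ^ (-u) with hw
  have hw0 : ∀ i, 0 ≤ w i := fun i => diff_nonneg hu0.le i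
  have hdiff : HasSum (fun i : ℕ => w i * (G (i + 1) - S)) ((∑' i : ℕ, a i * ((i : ℝ) + 1) ^ (-u)) - S) := by
    have := hT.sub (hW.mul_right S)
    rw [one_mul] at this
    refine this.congr_fun fun i => ?_
    simp only [hw, hG]
    ring
  -- estimate `Σ w_i |G(i+1) − S|`
  have habs_summable : Summable (fun i : ℕ => w i * |G (i + 1) - S|) := by
    refine Summable.of_nonneg_of_le (fun i => mul_nonneg (hw0 i) (abs_nonneg _))
      (fun i => mul_le_mul_of_nonneg_left (hK (i + 1)) (hw0 i)) (hW.summable.mul_right K)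
  have hbound : |(∑' i : ℕ, a i * ((i : ℝ) + 1) ^ (-u)) - S| ≤ ∑' i : ℕ, w i * |G (i + 1) - S| := by
    rw [← hdiff.tsum_eq]
    have h1 : ∀ i, ‖w i * (G (i + 1) - S)‖ = w i * |G (i + 1) - S| := fun i => by
      rw [Real.norm_eq_abs, abs_mul, abs_of_nonneg (hw0 i)]
    have := norm_tsum_le_tsum_norm (f := fun i : ℕ => w i * (G (i + 1) - S)) (by
      simpa only [h1] using habs_summable)
    simpa only [Real.norm_eq_abs, h1] using this
  -- split at `N₀`
  have hsplit := (habs_summable.sum_add_tsum_nat_add N₀).symm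
  have hhead : ∑ i ∈ Finset.range N₀, w i * |G (i + 1) - S| ≤ K * (1 - ((N₀ : ℝ) + 1) ^ (-u)) := by
    calc ∑ i ∈ Finset.range N₀, w i * |G (i + 1) - S|
        ≤ ∑ i ∈ Finset.range N₀, w i * K :=
          Finset.sum_le_sum fun i _ => mul_le_mul_of_nonneg_left (hK (i + 1)) (hw0 i)
      _ = K * (1 - ((N₀ : ℝ) + 1) ^ (-u)) := by
          rw [← Finset.sum_mul, mul_comm]
          simp only [hw]
          rw [sum_diff u N₀]
  have htail_w : ∑' i : ℕ, w (i + N₀) ≤ 1 := by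
    have h1 := (hW.summable.sum_add_tsum_nat_add N₀)
    have h2 : 0 ≤ ∑ i ∈ Finset.range N₀, w i := Finset.sum_nonneg fun i _ => hw0 i
    have h3 : (∑ i ∈ Finset.range N₀, w i) + ∑' i : ℕ, w (i + N₀) = 1 := by
      rw [h1]; exact hW.tsum_eq
    linarith
  have htail : ∑' i : ℕ, w (i + N₀) * |G (i + N₀ + 1) - S| ≤ ε / 2 := by
    have hs1 : Summable (fun i : ℕ => w (i + N₀) * |G (i + N₀ + 1) - S|) :=
      (summable_nat_add_iff N₀).2 habs_summable
    have hs2 : Summable (fun i : ℕ => w (i + N₀) * (ε / 2)) :=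
      ((summable_nat_add_iff N₀).2 hW.summable).mul_right _
    calc ∑' i : ℕ, w (i + N₀) * |G (i + N₀ + 1) - S|
        ≤ ∑' i : ℕ, w (i + N₀) * (ε / 2) :=
          hs1.tsum_le_tsum (fun i => mul_le_mul_of_nonneg_left (hN₀ _ (by omega)).le (hw0 _)) hs2
      _ = (∑' i : ℕ, w (i + N₀)) * (ε / 2) := tsum_mul_right
      _ ≤ 1 * (ε / 2) := mul_le_mul_of_nonneg_right htail_w (by linarith)
      _ = ε / 2 := one_mul _
  have hx1 : ((N₀ : ℝ) + 1) ^ (-u) ≤ 1 := weight_le_one hu0.le N₀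
  rw [Real.dist_eq]
  calc |(∑' i : ℕ, a i * ((i : ℝ) + 1) ^ (-u)) - S|
      ≤ ∑' i : ℕ, w i * |G (i + 1) - S| := hbound
    _ = (∑ i ∈ Finset.range N₀, w i * |G (i + 1) - S|) + ∑' i : ℕ, w (i + N₀) * |G (i + N₀ + 1) - S| := hsplit
    _ ≤ K * (1 - ((N₀ : ℝ) + 1) ^ (-u)) + ε / 2 := add_le_add hhead htail
    _ < ε := by nlinarith [hsmallu, hK0, hx1]

/-- **Anchor `abelDirichlet`** (registered sub-goal; `abel_dirichlet` with explicit quantifiers): Abel's theorem for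
Dirichlet series. [folklore] -/
theorem abelDirichlet : ∀ a : ℕ → ℝ, ∀ S : ℝ,
    Filter.Tendsto (fun N : ℕ => ∑ i ∈ Finset.range N, a i) Filter.atTop (nhds S) →
    (∀ u : ℝ, 0 < u → Summable (fun i : ℕ => a i * ((i : ℝ) + 1) ^ (-u))) →
    Filter.Tendsto (fun u : ℝ => ∑' i : ℕ, a i * ((i : ℝ) + 1) ^ (-u)) (nhdsWithin 0 (Set.Ioi 0)) (nhds S) :=
  fun _ _ hG hs => abel_dirichlet hG hs

end DirichletAbel

end Summit.RiemannHypothesis.RiemannHypothesis.Theorems.SignConeConeMagnification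

end
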